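import Summits.QuantumFields.BalabanUV.Beta.EriceFlowEnclosureB12AsPrintedHistoryContagionShiftFlowZeroSemigroupGellMannLowIntegral

/-!
# Beta / EriceFlowEnclosureB12AsPrintedHistoryContagionShiftFlowZeroSemigroupAverage — ASYMPTOTIC FREEDOM IS CONTAGIOUS, part 65: THE DISCRETE β-FUNCTION IS THE UNIT-SCALE
# AVERAGE OF THE CONTINUOUS ONE — Erice's page passes from the continuum equation (3.61) «dg⁻²(Λ)∕d ln Λ = β(g²(Λ), Λ)» to the recursion (3.62)
# «g_{n+1}^{−2} − g_n^{−2} = β_n(g_n²)» by absorbing ln L; for the flow with memory near the zero pin the two are related EXACTLY, with no differentiability hypothesis on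
# the functional: (§105, ABSTRACT: Λ strictly antitone on ]0, e′] onto `[Λ e′, ∞[`, part 35's lower chart bound) the chart of the continuous RG `s ↦ 1∕φ_s(g)²` is
# (3∕2)β₀-Lipschitz (part 51), hence ABSOLUTELY CONTINUOUS on every `[s₁, s₂] ⊆ [0, ∞[` (`chart_absolutelyContinuousOnInterval`), so by Lebesgue's FTC
# **`1∕φ_{s₂}(g)² − 1∕φ_{s₁}(g)² = ∫_{s₁}^{s₂} ∂_σ(1∕φ_σ(g)²) dσ`** with the ALMOST-EVERYWHERE chart velocity of parts 55–56 (`chart_integral_deriv`), which is a measurable,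
# essentially bounded function (`chartVelocity_ae_bounds`: `(3∕4)β₀ ≤ ∂_σ(1∕φ_σ²) ≤ (3∕2)β₀` a.e.); (§106, FOR THE FLOW: any dynamical Abel function, part 14's package)
# along every box solution h from every pin `e ∈ ]0, e′]`: **`B(h(k+1), h(k+2), …) = 1∕h(k+1)² − 1∕h(k)² = ∫_k^{k+1} ∂_σ(1∕φ_σ(e)²) dσ`**
# (**`functional_eq_average_chartVelocity`** — THE MEMORY FUNCTIONAL ON THE TRAJECTORY'S TAIL, i.e. the recursion's «β_n», IS THE AVERAGE OVER ONE UNIT OF RG TIME OF THE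
# CONTINUOUS CHART-GENERATOR, i.e. of (3.61)'s «β» read for the flow with memory), and part 57's a.e. bound `|∂_σ(1∕φ_σ²) − β₀| ≤ (3∕2)β₀κ·φ_σ(e)` integrates to
# `|B(tail_k) − β₀| ≤ (3∕2)β₀κ·h(k)` (`abs_functional_sub_le_of_average` — a continuous-RG derivation of part 33's one-step law, with the constant `(3∕2)β₀κ = 32β₀C_m∕((1−θ)β*)`
# in place of part 33's sharper `2C_m∕(1−θ)`: the discrete law is NOT improved, it is EXPLAINED).
# (β-flow team, prover 1 = recursion ∕ upper ∕ bare-coupling ∕ uniqueness side, unit `b2b-balaban-beta-bflow-p1`, gen 41; ROW AP-I·Uc × NODE U2 — the infinitesimal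
# renormalization group averaged; over part 59 (Mathlib's absolutely continuous FTC), part 57 (`abs_chartVelocity_sub_le`, `dynAbel_chart_bounds`), parts 55–56
# (`ae_differentiableAt_rg`, `hasDerivAt_rg_chart`), part 51 (`abs_rg_chart_sub_chart_le`), part 46 (`rg_mem_eq`, `rg_natCast_eq`, `rg_lt_rg_of_lt`), part 44, part 13, part 34)

HONEST FRAMING (page 1 of everything the β sub-cell writes): discharging `BetaPertH` makes Bałaban's UV stability UNCONDITIONAL — a
real constructive-QFT result; it is NOT the continuum limit and NOT the Clay problem.  HONEST DEPENDENCY (cell reorg 2026-08-19,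
verbatim): «continuum YM on T⁴ ⇐ BetaPertH ∧ nine spine estimates (0/9 proved); BetaPertH ⇐ (D1) ∧ (D4) ∧ CAP+tail; G-an2-4 gates
asym, D1 and NE2/3/4.»  THIS MODULE DISCHARGES NOTHING: [folklore] real analysis (a Lipschitz function is absolutely continuous; Lebesgue's FTC; monotonicity of the
integral under an a.e. bound — Mathlib) over node U2's HYPOTHESIS SHAPES on an ABSTRACT functional `B`; parts 13 ∕ 34 ∕ 44 ∕ 46 ∕ 51 ∕ 55–57 ∕ 59 BY NAME — nothing
restated.  Erice's (3.61)∕(3.62) (p. 248) are NAMED as the reading's motivation, NOT asserted: whether Bałaban's β or its limit functional satisfies either is not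
claimed; «continuous chart-generator», «unit-scale average» are OUR READING.  [I] = T. Bałaban, Commun. Math. Phys. **109** (1987) 249–301 [Balaban1987RG1]: Thm 2 (0.31)
p. 259, (0.18)–(0.20) pp. 255–256 — context of the row only; [BalabanJaffe1986] Part III §4 (3.61)∕(3.62) p. 248 — named, not asserted.

WHAT THIS FILE PROVES (0 sorry, 0 def): §105 `chart_lipschitzOnWith`, `chart_absolutelyContinuousOnInterval`, **`chart_integral_deriv`**, **`chartVelocity_ae_bounds`**;
§106 **`functional_eq_average_chartVelocity`**, **`abs_functional_sub_le_of_average`**.  NOT CLAIMED: anything about Bałaban's β; `BetaPertH`; continuum; Clay.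
-/

namespace Summit.QuantumFields.BalabanUV.Beta.EriceFlowEnclosureB12AsPrintedHistoryContagionShiftFlowZeroSemigroupAverage

open Filter Topology Set Function MeasureTheory intervalIntegral
open Literature.MathematicalPhysics.QuantumFieldTheory.Balaban1983to89
open Literature.MathematicalPhysics.QuantumFieldTheory.Balaban1983to89.T4BetaStationary (SeqBox MemoryProfile)
open Literature.MathematicalPhysics.QuantumFieldTheory.Balaban1983to89.T4BetaFlowWellPosed (MemFlow solution)
open Summit.QuantumFields.BalabanUV.Beta.EriceFlowEnclosureB12AsPrintedHistoryContagionShiftFlowPicardLimit (memFlow_solution_of_reference)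
open Summit.QuantumFields.BalabanUV.Beta.EriceFlowEnclosureB12AsPrintedHistoryContagionShiftFlowZeroOffset (package_of_le succ_le_of_reference_flow)
open Summit.QuantumFields.BalabanUV.Beta.EriceFlowEnclosureB12AsPrintedHistoryContagionShiftFlowZeroIsometry (dynAbel_shift)
open Summit.QuantumFields.BalabanUV.Beta.EriceFlowEnclosureB12AsPrintedHistoryContagionShiftFlowZeroSemigroup (rg_mem_eq rg_natCast_eq rg_lt_rg_of_lt)
open Summit.QuantumFields.BalabanUV.Beta.EriceFlowEnclosureB12AsPrintedHistoryContagionShiftFlowZeroSemigroupOneLoop (abs_rg_chart_sub_chart_le)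
open Summit.QuantumFields.BalabanUV.Beta.EriceFlowEnclosureB12AsPrintedHistoryContagionShiftFlowZeroSemigroupVelocity (ae_differentiableAt_rg)
open Summit.QuantumFields.BalabanUV.Beta.EriceFlowEnclosureB12AsPrintedHistoryContagionShiftFlowZeroSemigroupGellMannLow (hasDerivAt_rg_chart)
open Summit.QuantumFields.BalabanUV.Beta.EriceFlowEnclosureB12AsPrintedHistoryContagionShiftFlowZeroSemigroupGellMannLowOneLoop (dynAbel_chart_bounds abs_chartVelocity_sub_le)

noncomputable section

variable {Λ : ℝ → ℝ} {e' β₀ : ℝ}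

/-! ## §105 The chart of the continuous RG is absolutely continuous in the scale (abstract) -/

/-- The chart `s ↦ 1∕φ_s(g)²` is `(3∕2)β₀`-Lipschitz on every `[s₁, s₂] ⊆ [0, ∞[` (part 51's bound, packaged). [folklore] -/
theorem chart_lipschitzOnWith (hanti : StrictAntiOn Λ (Ioc 0 e')) (honto : ∀ y : ℝ, Λ e' ≤ y → ∃ x ∈ Ioc (0 : ℝ) e', Λ x = y) (hβ₀ : 0 < β₀)
    (hlo : ∀ e₁ ∈ Ioc (0 : ℝ) e', ∀ e₂ ∈ Ioc (0 : ℝ) e', e₁ ≤ e₂ → 2 / 3 * (1 / e₁ ^ 2 - 1 / e₂ ^ 2) ≤ Λ e₁ - Λ e₂)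
    {g s₁ s₂ : ℝ} (hg : g ∈ Ioc (0 : ℝ) e') (hs₁ : 0 ≤ s₁) (h12 : s₁ ≤ s₂) :
    LipschitzOnWith (Real.toNNReal (3 / 2 * β₀)) (fun σ : ℝ => 1 / invFunOn Λ (Ioc 0 e') (Λ g + σ * β₀) ^ 2) (uIcc s₁ s₂) := by
  refine LipschitzOnWith.of_dist_le' fun x hx y hy => ?_
  rw [uIcc_of_le h12] at hx hy
  rw [Real.dist_eq, Real.dist_eq]
  exact abs_rg_chart_sub_chart_le hanti honto hβ₀ hlo hg (hs₁.trans hy.1) (hs₁.trans hx.1)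

/-- … hence ABSOLUTELY CONTINUOUS on `[s₁, s₂]`. [folklore] -/
theorem chart_absolutelyContinuousOnInterval (hanti : StrictAntiOn Λ (Ioc 0 e')) (honto : ∀ y : ℝ, Λ e' ≤ y → ∃ x ∈ Ioc (0 : ℝ) e', Λ x = y) (hβ₀ : 0 < β₀)
    (hlo : ∀ e₁ ∈ Ioc (0 : ℝ) e', ∀ e₂ ∈ Ioc (0 : ℝ) e', e₁ ≤ e₂ → 2 / 3 * (1 / e₁ ^ 2 - 1 / e₂ ^ 2) ≤ Λ e₁ - Λ e₂)
    {g s₁ s₂ : ℝ} (hg : g ∈ Ioc (0 : ℝ) e') (hs₁ : 0 ≤ s₁) (h12 : s₁ ≤ s₂) :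
    AbsolutelyContinuousOnInterval (fun σ : ℝ => 1 / invFunOn Λ (Ioc 0 e') (Λ g + σ * β₀) ^ 2) s₁ s₂ :=
  (chart_lipschitzOnWith hanti honto hβ₀ hlo hg hs₁ h12).absolutelyContinuousOnInterval

/-- **LEBESGUE'S FTC FOR THE CHART OF THE CONTINUOUS RG**: for `g ∈ ]0, e′]` and `0 ≤ s₁ ≤ s₂`:
**`∫_{s₁}^{s₂} ∂_σ(1∕φ_σ(g)²) dσ = 1∕φ_{s₂}(g)² − 1∕φ_{s₁}(g)²`**, the integrand being the ALMOST-EVERYWHERE chart velocity `deriv (σ ↦ 1∕φ_σ(g)²)` of parts 55–56 — no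
differentiability hypothesis. [folklore] -/
theorem chart_integral_deriv (hanti : StrictAntiOn Λ (Ioc 0 e')) (honto : ∀ y : ℝ, Λ e' ≤ y → ∃ x ∈ Ioc (0 : ℝ) e', Λ x = y) (hβ₀ : 0 < β₀)
    (hlo : ∀ e₁ ∈ Ioc (0 : ℝ) e', ∀ e₂ ∈ Ioc (0 : ℝ) e', e₁ ≤ e₂ → 2 / 3 * (1 / e₁ ^ 2 - 1 / e₂ ^ 2) ≤ Λ e₁ - Λ e₂)
    {g s₁ s₂ : ℝ} (hg : g ∈ Ioc (0 : ℝ) e') (hs₁ : 0 ≤ s₁) (h12 : s₁ ≤ s₂) :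
    ∫ σ in s₁..s₂, deriv (fun σ : ℝ => 1 / invFunOn Λ (Ioc 0 e') (Λ g + σ * β₀) ^ 2) σ
      = 1 / invFunOn Λ (Ioc 0 e') (Λ g + s₂ * β₀) ^ 2 - 1 / invFunOn Λ (Ioc 0 e') (Λ g + s₁ * β₀) ^ 2 :=
  (chart_absolutelyContinuousOnInterval hanti honto hβ₀ hlo hg hs₁ h12).integral_deriv_eq_sub

/-- **THE CHART VELOCITY IS AN ESSENTIALLY BOUNDED FUNCTION**: with both chart bounds, for every `g ∈ ]0, e′]` and a.e. `s > 0`: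
**`(3∕4)β₀ ≤ deriv (σ ↦ 1∕φ_σ(g)²) s ≤ (3∕2)β₀`** — the continuous chart-generator is an `L^∞` function on the scale axis. [folklore] -/
theorem chartVelocity_ae_bounds (hanti : StrictAntiOn Λ (Ioc 0 e')) (honto : ∀ y : ℝ, Λ e' ≤ y → ∃ x ∈ Ioc (0 : ℝ) e', Λ x = y) (hβ₀ : 0 < β₀)
    (hbounds : ∀ e₁ ∈ Ioc (0 : ℝ) e', ∀ e₂ ∈ Ioc (0 : ℝ) e', e₁ ≤ e₂ →
      2 / 3 * (1 / e₁ ^ 2 - 1 / e₂ ^ 2) ≤ Λ e₁ - Λ e₂ ∧ Λ e₁ - Λ e₂ ≤ 4 / 3 * (1 / e₁ ^ 2 - 1 / e₂ ^ 2))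
    {g : ℝ} (hg : g ∈ Ioc (0 : ℝ) e') :
    ∀ᵐ s, s ∈ Ioi (0 : ℝ) → 3 / 4 * β₀ ≤ deriv (fun σ : ℝ => 1 / invFunOn Λ (Ioc 0 e') (Λ g + σ * β₀) ^ 2) s ∧
      deriv (fun σ : ℝ => 1 / invFunOn Λ (Ioc 0 e') (Λ g + σ * β₀) ^ 2) s ≤ 3 / 2 * β₀ := by
  have he' : e' ∈ Ioc (0 : ℝ) e' := ⟨hg.1.trans_le hg.2, le_rfl⟩
  have hΛg : Λ e' ≤ Λ g := hanti.antitoneOn hg he' hg.2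
  filter_upwards [ae_differentiableAt_rg hanti honto hβ₀ hg] with s hs hso
  have hgs : Λ e' < Λ g + s * β₀ := by have := mul_pos (mem_Ioi.1 hso) hβ₀; linarith
  have hV := (hs hso).hasDerivAt
  obtain ⟨hder, h1, h2⟩ := hasDerivAt_rg_chart hanti honto hβ₀ hbounds hgs hV
  rw [hder.deriv]
  exact ⟨h1, h2⟩

/-! ## §106 For the flow: the memory functional on the trajectory's tail is the unit-scale average of the continuous chart-generator -/

/-- **THE RECURSION'S β IS THE UNIT-SCALE AVERAGE OF THE CONTINUOUS β.**  `B` with memory profile `(C_m, θ)` on ]0, γ]^ℕ and value-at-zero letter β₀ > 0; ONE AF reference;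
part 14's package at e′; Λ any dynamical Abel function, strictly antitone on ]0, e′] onto `[Λ e′, ∞[`.  THEN along every box solution h from every pin `e ∈ ]0, e′]` and for
every k: **`B(h(k+1), h(k+2), …) = 1∕h(k+1)² − 1∕h(k)² = ∫_k^{k+1} ∂_σ(1∕φ_σ(e)²) dσ`** — the memory functional evaluated on the trajectory's ultraviolet tail (the «β_n» of
the recursion) equals the integral over one unit of RG time of the almost-everywhere chart velocity of the continuous renormalization group (the «β» of the continuum
equation, read for the flow with memory). [cite: Balaban1987RG1, Thm 2 (0.31) p.259 with (0.18)–(0.20) pp.255–256; reading of BalabanJaffe1986 (3.61)∕(3.62) p.248] -/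
theorem functional_eq_average_chartVelocity {B : (ℕ → ℝ) → ℝ} {Cm θ γ β₀ bs ta gs e' e : ℝ} {t h : ℕ → ℝ} {a : ℕ → ℝ} {Λ : ℝ → ℝ}
    (hB : MemoryProfile Cm θ γ B) (hCm : 0 ≤ Cm) (hθ0 : 0 ≤ θ) (hθ1 : θ < 1) (hbs : 0 < bs) (hta : 0 < ta)
    (h0 : ∀ u : ℕ → ℝ, SeqBox γ u → |B u - β₀| ≤ Cm * ∑' j, θ ^ j * u j)
    (hts : SeqBox γ t) (htf : MemFlow B gs t) (hprof : ∀ m : ℕ, 1 / ta ^ 2 + bs * (m : ℝ) ≤ 1 / (t m) ^ 2)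
    (hΛ : ∀ e ∈ Ioc (0 : ℝ) e', ∀ h : ℕ → ℝ, SeqBox γ h → MemFlow B e h → Tendsto (fun n => 1 / h n ^ 2 - a n) atTop (𝓝 (Λ e)))
    (hanti : StrictAntiOn Λ (Ioc 0 e')) (honto : ∀ y : ℝ, Λ e' ≤ y → ∃ x ∈ Ioc (0 : ℝ) e', Λ x = y) (hβ₀ : 0 < β₀)
    (h2e' : 2 * e' ≤ γ)
    (hs1 : 4 * Cm * e' ≤ bs * (1 - θ))
    (hs2 : e' ^ 2 * (1 / gs ^ 2 + Cm * γ / (1 - θ) ^ 2 + (2 * Cm / ((1 - θ) * bs)) ^ 2) ≤ 3 / 4)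
    (hs4 : 64 * Cm * e' ^ 3 ≤ (1 - θ) ^ 2) (hs5 : Cm * (8 * e' ^ 3 + 16 * e' / bs) ≤ (1 - θ) / 4)
    (he : e ∈ Ioc (0 : ℝ) e') (hhs : SeqBox γ h) (hhf : MemFlow B e h) (k : ℕ) :
    B (fun j => h (k + 1 + j)) = 1 / h (k + 1) ^ 2 - 1 / h k ^ 2 ∧
      1 / h (k + 1) ^ 2 - 1 / h k ^ 2
        = ∫ σ in (k : ℝ)..((k : ℝ) + 1), deriv (fun σ : ℝ => 1 / invFunOn Λ (Ioc 0 e') (Λ e + σ * β₀) ^ 2) σ := by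
  have hγ : 0 ≤ γ := by linarith [he.1, he.2]
  have hbounds := dynAbel_chart_bounds hB hCm hθ0 hθ1 hbs hta hts htf hprof hΛ h2e' hs1 hs2 hs4 hs5
  obtain ⟨p1, p2, -, -⟩ := package_of_le hCm hθ1 hbs hγ he.1 he.2 hs1 hs2 hs4 hs5
  have habel : ∀ k : ℕ, Λ (h k) = Λ e + (k : ℝ) * β₀ := fun k =>
    dynAbel_shift hB hCm hθ0 hθ1 hbs hta h0 hts htf hprof hΛ he hhs hhf p1 p2 k
  have hkmem : ∀ k, h k ∈ Ioc (0 : ℝ) e' := fun k =>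
    ⟨(hhs k).1, (succ_le_of_reference_flow hB hCm hθ0 hθ1 hbs hta h0 hts htf hprof hhs hhf p1 p2 k).2.2.trans he.2⟩
  have horb : ∀ k : ℕ, invFunOn Λ (Ioc 0 e') (Λ e + (k : ℝ) * β₀) = h k := fun k => rg_natCast_eq hanti honto hβ₀.le he hkmem habel k
  refine ⟨by rw [hhf.2 k]; ring, ?_⟩
  have hftc := chart_integral_deriv hanti honto hβ₀ (fun e₁ h₁ e₂ h₂ h => (hbounds e₁ h₁ e₂ h₂ h).1) he (Nat.cast_nonneg k)
    (by linarith : (k : ℝ) ≤ (k : ℝ) + 1)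
  rw [hftc, horb k]
  have : invFunOn Λ (Ioc 0 e') (Λ e + ((k : ℝ) + 1) * β₀) = h (k + 1) := by
    have := horb (k + 1); push_cast at this; exact this
  rw [this]

/-- **… SO PART 33's ONE-STEP LAW FOLLOWS FROM THE A.E. GENERATOR**: in the same setting, **`|B(h(k+1), h(k+2), …) − β₀| ≤ (3∕2)β₀κ·h(k)`**, `κ = 64C_m∕(3(1−θ)β*)` — part 57's
a.e. bound `|∂_σ(1∕φ_σ²) − β₀| ≤ (3∕2)β₀κ·φ_σ(e)` integrated over `σ ∈ [k, k+1]`, where `φ_σ(e) ≤ φ_k(e) = h(k)`.  (Part 33's direct constant `2C_m∕(1−θ)` is sharper; the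
point is the derivation, not the constant.) [cite: Balaban1987RG1, Thm 2 (0.31) p.259 with (0.18)–(0.20) pp.255–256] -/
theorem abs_functional_sub_le_of_average {B : (ℕ → ℝ) → ℝ} {Cm θ γ β₀ bs ta gs e' e : ℝ} {t h : ℕ → ℝ} {a : ℕ → ℝ} {Λ : ℝ → ℝ}
    (hB : MemoryProfile Cm θ γ B) (hCm : 0 ≤ Cm) (hθ0 : 0 ≤ θ) (hθ1 : θ < 1) (hbs : 0 < bs) (hta : 0 < ta)
    (h0 : ∀ u : ℕ → ℝ, SeqBox γ u → |B u - β₀| ≤ Cm * ∑' j, θ ^ j * u j)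
    (hts : SeqBox γ t) (htf : MemFlow B gs t) (hprof : ∀ m : ℕ, 1 / ta ^ 2 + bs * (m : ℝ) ≤ 1 / (t m) ^ 2)
    (hΛ : ∀ e ∈ Ioc (0 : ℝ) e', ∀ h : ℕ → ℝ, SeqBox γ h → MemFlow B e h → Tendsto (fun n => 1 / h n ^ 2 - a n) atTop (𝓝 (Λ e)))
    (hanti : StrictAntiOn Λ (Ioc 0 e')) (honto : ∀ y : ℝ, Λ e' ≤ y → ∃ x ∈ Ioc (0 : ℝ) e', Λ x = y) (hβ₀ : 0 < β₀)
    (h2e' : 2 * e' ≤ γ)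
    (hs1 : 4 * Cm * e' ≤ bs * (1 - θ))
    (hs2 : e' ^ 2 * (1 / gs ^ 2 + Cm * γ / (1 - θ) ^ 2 + (2 * Cm / ((1 - θ) * bs)) ^ 2) ≤ 3 / 4)
    (hs4 : 64 * Cm * e' ^ 3 ≤ (1 - θ) ^ 2) (hs5 : Cm * (8 * e' ^ 3 + 16 * e' / bs) ≤ (1 - θ) / 4)
    (he : e ∈ Ioc (0 : ℝ) e') (hhs : SeqBox γ h) (hhf : MemFlow B e h) (k : ℕ) :
    |B (fun j => h (k + 1 + j)) - β₀| ≤ 3 / 2 * β₀ * (64 * Cm / (3 * (1 - θ) * bs)) * h k := by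
  set κ := 64 * Cm / (3 * (1 - θ) * bs) with hκdef
  have hγ : 0 ≤ γ := by linarith [he.1, he.2]
  have h1θ : 0 < 1 - θ := by linarith
  have hκ0 : 0 ≤ κ := by positivity
  have hbounds := dynAbel_chart_bounds hB hCm hθ0 hθ1 hbs hta hts htf hprof hΛ h2e' hs1 hs2 hs4 hs5
  have hlo : ∀ e₁ ∈ Ioc (0 : ℝ) e', ∀ e₂ ∈ Ioc (0 : ℝ) e', e₁ ≤ e₂ → 2 / 3 * (1 / e₁ ^ 2 - 1 / e₂ ^ 2) ≤ Λ e₁ - Λ e₂ :=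
    fun e₁ h₁ e₂ h₂ h => (hbounds e₁ h₁ e₂ h₂ h).1
  obtain ⟨p1, p2, -, -⟩ := package_of_le hCm hθ1 hbs hγ he.1 he.2 hs1 hs2 hs4 hs5
  have habel : ∀ k : ℕ, Λ (h k) = Λ e + (k : ℝ) * β₀ := fun k =>
    dynAbel_shift hB hCm hθ0 hθ1 hbs hta h0 hts htf hprof hΛ he hhs hhf p1 p2 k
  have hkmem : ∀ k, h k ∈ Ioc (0 : ℝ) e' := fun k =>
    ⟨(hhs k).1, (succ_le_of_reference_flow hB hCm hθ0 hθ1 hbs hta h0 hts htf hprof hhs hhf p1 p2 k).2.2.trans he.2⟩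
  have horb : invFunOn Λ (Ioc 0 e') (Λ e + (k : ℝ) * β₀) = h k := rg_natCast_eq hanti honto hβ₀.le he hkmem habel k
  obtain ⟨hBeq, havg⟩ := functional_eq_average_chartVelocity hB hCm hθ0 hθ1 hbs hta h0 hts htf hprof hΛ hanti honto hβ₀ h2e' hs1 hs2 hs4 hs5 he hhs hhf k
  rw [hBeq, havg]
  have hk0 : (0 : ℝ) ≤ k := Nat.cast_nonneg k
  have hk1 : (k : ℝ) ≤ (k : ℝ) + 1 := by linarith
  have he' : e' ∈ Ioc (0 : ℝ) e' := ⟨he.1.trans_le he.2, le_rfl⟩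
  have hΛe : Λ e' ≤ Λ e := hanti.antitoneOn he he' he.2
  -- the integrand minus β₀ is a.e. bounded by (3∕2)β₀κ·h k on [k, k+1]
  set F : ℝ → ℝ := fun σ => deriv (fun σ : ℝ => 1 / invFunOn Λ (Ioc 0 e') (Λ e + σ * β₀) ^ 2) σ with hFdef
  have hac := chart_absolutelyContinuousOnInterval hanti honto hβ₀ hlo he hk0 hk1
  have hint : IntervalIntegrable F volume (k : ℝ) ((k : ℝ) + 1) := hac.intervalIntegrable_deriv
  have hne : ∀ᵐ σ ∂volume, σ ∉ ({0} : Set ℝ) := measure_eq_zero_iff_ae_notMem.1 Real.volume_singleton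
  have hbd : ∀ᵐ σ ∂volume.restrict (Icc (k : ℝ) ((k : ℝ) + 1)),
      β₀ - 3 / 2 * β₀ * κ * h k ≤ F σ ∧ F σ ≤ β₀ + 3 / 2 * β₀ * κ * h k := by
    rw [ae_restrict_iff' measurableSet_Icc]
    filter_upwards [ae_differentiableAt_rg hanti honto hβ₀ he, hne] with σ hσ hσne hσI
    have hσ0 : 0 < σ := lt_of_le_of_ne (hk0.trans hσI.1) (fun h0' => hσne (by rw [← h0']; rfl))
    have hgs : Λ e' < Λ e + σ * β₀ := by have := mul_pos hσ0 hβ₀; linarith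
    have hV := (hσ (mem_Ioi.2 hσ0)).hasDerivAt
    obtain ⟨hder, hrel⟩ := abs_chartVelocity_sub_le hB hCm hθ0 hθ1 hbs hta hts htf hprof hΛ hanti honto hβ₀ h2e' hs1 hs2 hs4 hs5 hgs hV
    have hFσ : F σ = -2 * deriv (fun σ : ℝ => invFunOn Λ (Ioc 0 e') (Λ e + σ * β₀)) σ / invFunOn Λ (Ioc 0 e') (Λ e + σ * β₀) ^ 3 := by
      rw [hFdef]; exact hder.deriv
    rw [hFσ]
    -- the running coupling at scale σ ≥ k is below h k
    have hxle : invFunOn Λ (Ioc 0 e') (Λ e + σ * β₀) ≤ h k := by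
      rw [← horb]
      rcases hσI.1.lt_or_eq with hlt | heq
      · exact (rg_lt_rg_of_lt hanti honto hβ₀ he hk0 hlt).le
      · rw [heq]
    have hmono : 3 / 2 * β₀ * κ * invFunOn Λ (Ioc 0 e') (Λ e + σ * β₀) ≤ 3 / 2 * β₀ * κ * h k :=
      mul_le_mul_of_nonneg_left hxle (by positivity)
    obtain ⟨h1, h2⟩ := abs_le.1 hrel
    constructor <;> linarith
  have hI1 := intervalIntegral.integral_mono_ae_restrict hk1 (intervalIntegrable_const (c := β₀ - 3 / 2 * β₀ * κ * h k)) hint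
    (hbd.mono fun σ hσ => hσ.1)
  have hI2 := intervalIntegral.integral_mono_ae_restrict hk1 hint (intervalIntegrable_const (c := β₀ + 3 / 2 * β₀ * κ * h k))
    (hbd.mono fun σ hσ => hσ.2)
  rw [intervalIntegral.integral_const, show (k : ℝ) + 1 - k = 1 by ring, one_smul] at hI1 hI2
  rw [abs_le]
  constructor <;> linarith

end

end Summit.QuantumFields.BalabanUV.Beta.EriceFlowEnclosureB12AsPrintedHistoryContagionShiftFlowZeroSemigroupAverage
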